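import Summits.CriticalPhenomena.PercolationContinuityZ3.Theorems.Transplant.CayleyMilnorTransitive
import HarnessLib

/-!
# The relative Milnor lemma for actions by automorphisms, I: words — `2^m` distinct ORBIT points `Q_m(ε) • t` unless some conjugate
# `x^n a x^{-n}` lies in the span of the STABILISER and the earlier conjugates; Reidemeister–Schreier over a generating set

builds on p205010 (kernel theorem, internal audit signed; external expert review pending) — nothing in this file uses p205010 and nothing here is about percolation.  Lane `prim-bschramm`, seat `prim-bschramm-p4` gen 25
(PART C3 of `P4-GENERAL.md` §47: INPUT(G) WITHOUT FINITE STABILISERS).  Helper file (`--supports stmt-CriticalPhenomena-4575 --as helper`).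

WHY.  Gen 17–24's chart-free INPUT(G) (`AutScaled.criticalContinuity`) asks for a transitive group `A` of automorphisms with FINITE vertex
stabilisers and `b₁(A) ≥ 2`; finiteness of the stabiliser was used to make `A` finitely generated and of the growth of `G`, so that Milnor's
lemma (files `CayleyMilnorWords/Kernel`) makes `ker (A → ℤ²)` finitely generated — which is what connects the cylinders of the skeleton chart.
With INFINITE stabilisers `A` need not be finitely generated and a finitely generated transitive subgroup may grow exponentially although `G`
does not (lamplighter-type actions on bounded blow-ups of `ℤ²`), so Milnor's lemma cannot be applied to any group.  The cure is to run
Milnor's argument ON THE ORBIT: for `x, a` in a group `B` acting by automorphisms on `G` with base vertex `t`,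
* §1 displacements `g • t ∈ B(t, r)` add under products, are symmetric, vanish on `Stab(t)`;
* §2 the LEFT-appended products `Q_m(ε) = c_m^{ε_m} ⋯ c_1^{ε_1}` (`c_j = x^j a x^{-j}`) telescope to `x^m T_m(ε)` with `T_m(ε) • t ∈ B(t, m(r_a+r_x))`;
* §3 if `c_{j+1} ∉ ⟨Stab(t), c_1, …, c_j⟩` for `j < m` then `ε ↦ Q_m(ε) • t` is INJECTIVE (equal left-most letters cancel as permutations of `V`,
  unequal ones put `c_m` into the relative span — this is why the letters are appended on the left);
* §4–§5 hence `2^m ≤ |B(t, m(r_a+r_x+1))|`, so if `|B(t, mR)| < 2^m` for some `m` (subexponential growth of `G` AT `t` along the scale `R`),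
  some `c_n`, `1 ≤ n ≤ m`, lies in `⟨Stab(t), c_1, …, c_{n−1}⟩` — with a bound `m` depending on `x, a` only through their displacements, hence
  UNIFORM over all `a ∈ Stab(t)` (displacement `0`);
* §6 Reidemeister–Schreier over a generating SET `S₀`: `⟨S₀⟩ ∩ ker ψ = ⟨x^k a_s x^{-k} : s ∈ S₀, k ∈ ℤ⟩` (the tree's `Milnor.closure_inf_ker_eq`
  verbatim for sets), and a generator of `ψ(B') ≤ ℤ` attained on any subgroup `B'`.
Sequel: `AutRelMilnorKernel` (the kernel is generated by elements of bounded displacement), `AutRelMilnorKernelTwo` (`ℤ²`),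
`AutChartDatum`/`AutChartCylinders`/`AutChartCriticalContinuity` (the one-type scaled skeleton and the theorem).
[cite: MilnorSolvableGrowth1968, Lemma 1 pp. 447–448] [cite: Rosset1976, Thm. 1] [cite: BenjaminiSchramm1996, §2 (almost transitive graphs)]
-/

noncomputable section

namespace Summit.CriticalPhenomena.PercolationContinuityZ3.Theorems.Transplant

open SimpleGraph Filter Literature.Barriers.CriticalPhenomena Literature.Probability.LatticeModels Literature.Probability.Percolation
open scoped Classical

namespace AutMilnor

variable {V : Type} {G : SimpleGraph V} {B : Type} [Group B] [MulAction B V]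

/-! ## §1 Displacement of the base vertex under an action by automorphisms -/

/-- **Displacements add**: `g•t ∈ B(t,m)`, `h•t ∈ B(t,n)` ⟹ `(gh)•t ∈ B(t,m+n)` (`g` is an isometry). [folklore] -/
theorem mul_smul_mem_graphBall (hact : IsActionByAut G B) {t : V} {g h : B} {m n : ℕ} (hg : g • t ∈ graphBall G t m)
    (hh : h • t ∈ graphBall G t n) : (g * h) • t ∈ graphBall G t (m + n) := by
  rw [mul_smul]
  exact mem_graphBall_add G hg ((smul_mem_graphBall_iff hact g).2 hh)

/-- **Displacements are symmetric**: `g•t ∈ B(t,m)` ⟹ `g⁻¹•t ∈ B(t,m)`. [folklore] -/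
theorem inv_smul_mem_graphBall (hact : IsActionByAut G B) {t : V} {g : B} {m : ℕ} (hg : g • t ∈ graphBall G t m) :
    g⁻¹ • t ∈ graphBall G t m := by
  have h := (smul_mem_graphBall_iff hact g⁻¹).2 hg
  rw [inv_smul_smul] at h
  exact (mem_graphBall_comm G).1 h

/-- A stabiliser element does not move the base vertex. [folklore] -/
theorem smul_mem_graphBall_of_mem_stabilizer {t : V} {h : B} (hh : h ∈ MulAction.stabilizer B t) (n : ℕ) :
    h • t ∈ graphBall G t n := by
  rw [MulAction.mem_stabilizer_iff.1 hh]
  exact mem_graphBall_self G t n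

/-- Powers: `g•t ∈ B(t,r)` ⟹ `g^k • t ∈ B(t, k r)`. [folklore] -/
theorem pow_smul_mem_graphBall (hact : IsActionByAut G B) {t : V} {g : B} {r : ℕ} (hg : g • t ∈ graphBall G t r) :
    ∀ k : ℕ, (g ^ k) • t ∈ graphBall G t (k * r)
  | 0 => by rw [pow_zero, one_smul, Nat.zero_mul]; exact mem_graphBall_self G t 0
  | k + 1 => by
    rw [pow_succ, show (k + 1) * r = k * r + r by ring]
    exact mul_smul_mem_graphBall hact (pow_smul_mem_graphBall hact hg k) hg

/-- Integer powers: `g•t ∈ B(t,r)` ⟹ `g^k • t ∈ B(t, |k| r)`. [folklore] -/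
theorem zpow_smul_mem_graphBall (hact : IsActionByAut G B) {t : V} {g : B} {r : ℕ} (hg : g • t ∈ graphBall G t r) (k : ℤ) :
    (g ^ k) • t ∈ graphBall G t (k.natAbs * r) := by
  rcases Int.eq_nat_or_neg k with ⟨j, rfl | rfl⟩
  · rw [zpow_natCast, Int.natAbs_natCast]
    exact pow_smul_mem_graphBall hact hg j
  · rw [zpow_neg, zpow_natCast, Int.natAbs_neg, Int.natAbs_natCast]
    exact inv_smul_mem_graphBall hact (pow_smul_mem_graphBall hact hg j)

/-- Conjugates: `x•t ∈ B(t,rx)`, `a•t ∈ B(t,ra)` ⟹ `(x^k a x^{-k})•t ∈ B(t, 2|k| rx + ra)`. [folklore] -/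
theorem zpow_conj_smul_mem_graphBall (hact : IsActionByAut G B) {t : V} {x a : B} {rx ra : ℕ} (hx : x • t ∈ graphBall G t rx)
    (ha : a • t ∈ graphBall G t ra) (k : ℤ) : (x ^ k * a * (x ^ k)⁻¹) • t ∈ graphBall G t (2 * (k.natAbs * rx) + ra) := by
  rw [show 2 * (k.natAbs * rx) + ra = (k.natAbs * rx + ra) + k.natAbs * rx by ring]
  exact mul_smul_mem_graphBall hact (mul_smul_mem_graphBall hact (zpow_smul_mem_graphBall hact hx k) ha)
    (inv_smul_mem_graphBall hact (zpow_smul_mem_graphBall hact hx k))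

/-! ## §2 Left-appended products of conjugates `c_m^{ε_m} ⋯ c_1^{ε_1}` and their telescoped tails -/

/-- The LEFT-appended ordered product `Q_m(ε) = c_m^{ε_{m−1}} ⋯ c_1^{ε₀}`, `c_j = x^j a x^{-j}`.
[cite: MilnorSolvableGrowth1968, p. 448 (the relation α_1^{i_1} ⋯ α_m^{i_m})] -/
def lword (x a : B) : (m : ℕ) → (Fin m → Bool) → B
  | 0, _ => 1
  | m + 1, ε => (if ε (Fin.last m) then Milnor.conj x a (m + 1) else 1) * lword x a m (Fin.init ε)

/-- The telescoped tail `T_m(ε) = (a^{ε_{m−1}} x⁻¹) ⋯ (a^{ε₀} x⁻¹)` with `Q_m(ε) = x^m T_m(ε)`.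
[cite: MilnorSolvableGrowth1968, p. 447 (the 2^m expressions βα^{i_1} ⋯ βα^{i_m})] -/
def tail (x a : B) : (m : ℕ) → (Fin m → Bool) → B
  | 0, _ => 1
  | m + 1, ε => (if ε (Fin.last m) then a else 1) * x⁻¹ * tail x a m (Fin.init ε)

/-- **Telescoping**: `Q_m(ε) = x^m · T_m(ε)`. [cite: MilnorSolvableGrowth1968, p. 447] -/
theorem lword_eq (x a : B) : ∀ (m : ℕ) (ε : Fin m → Bool), lword x a m ε = x ^ m * tail x a m ε
  | 0, ε => by simp [lword, tail]
  | m + 1, ε => by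
    rw [lword, tail, lword_eq x a m]
    simp only [Milnor.conj]
    split_ifs
    · rw [pow_succ]; group
    · rw [pow_succ]; group

/-- **The tail moves the base vertex by at most `m (r_a + r_x)`.** [cite: MilnorSolvableGrowth1968, p. 447] -/
theorem tail_smul_mem (hact : IsActionByAut G B) {t : V} {x a : B} {rx ra : ℕ} (hx : x⁻¹ • t ∈ graphBall G t rx)
    (ha : a • t ∈ graphBall G t ra) : ∀ (m : ℕ) (ε : Fin m → Bool), tail x a m ε • t ∈ graphBall G t (m * (ra + rx))
  | 0, ε => by rw [tail, one_smul, Nat.zero_mul]; exact mem_graphBall_self G t 0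
  | m + 1, ε => by
    rw [tail, show (m + 1) * (ra + rx) = (ra + rx) + m * (ra + rx) by ring]
    refine mul_smul_mem_graphBall hact (mul_smul_mem_graphBall hact ?_ hx) (tail_smul_mem hact hx ha m _)
    split_ifs
    · exact ha
    · rw [one_smul]; exact mem_graphBall_self G t ra

/-- **The `2^m` vertices `Q_m(ε) • t` lie in the ball of radius `m (r_a + r_x)` about `x^m • t`.** [cite: MilnorSolvableGrowth1968, p. 447] -/
theorem lword_smul_mem (hact : IsActionByAut G B) {t : V} {x a : B} {rx ra : ℕ} (hx : x⁻¹ • t ∈ graphBall G t rx)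
    (ha : a • t ∈ graphBall G t ra) (m : ℕ) (ε : Fin m → Bool) :
    lword x a m ε • t ∈ graphBall G ((x ^ m) • t) (m * (ra + rx)) := by
  rw [lword_eq, mul_smul]
  exact (smul_mem_graphBall_iff hact (x ^ m)).2 (tail_smul_mem hact hx ha m ε)

/-- `Q_m(ε) ∈ ⟨c_1, …, c_m⟩`. [cite: MilnorSolvableGrowth1968, p. 448] -/
theorem lword_mem (x a : B) : ∀ (m : ℕ) (ε : Fin m → Bool), lword x a m ε ∈ Subgroup.closure (Milnor.conj x a '' Set.Icc 1 m)
  | 0, _ => by rw [lword]; exact one_mem _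
  | m + 1, ε => by
    have hmono : Subgroup.closure (Milnor.conj x a '' Set.Icc 1 m) ≤ Subgroup.closure (Milnor.conj x a '' Set.Icc 1 (m + 1)) :=
      Subgroup.closure_mono (Set.image_mono (Set.Icc_subset_Icc_right (by omega)))
    rw [lword]
    refine mul_mem ?_ (hmono (lword_mem x a m _))
    split_ifs
    · exact Subgroup.subset_closure ⟨m + 1, ⟨by omega, le_rfl⟩, rfl⟩
    · exact one_mem _

/-! ## §3 Independence MODULO THE STABILISER makes `ε ↦ Q_m(ε) • t` injective -/

/-- The relative span `⟨Stab(t), c_1, …, c_j⟩`. [cite: MilnorSolvableGrowth1968, p. 448] -/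
def relSpan (t : V) (x a : B) (j : ℕ) : Subgroup B :=
  Subgroup.closure (↑(MulAction.stabilizer B t) ∪ Milnor.conj x a '' Set.Icc 1 j)

/-- `⟨c_1, …, c_j⟩ ≤ ⟨Stab(t), c_1, …, c_j⟩`. [folklore] -/
theorem closure_le_relSpan (t : V) (x a : B) (j : ℕ) : Subgroup.closure (Milnor.conj x a '' Set.Icc 1 j) ≤ relSpan t x a j :=
  Subgroup.closure_mono Set.subset_union_right

/-- `Stab(t) ≤ ⟨Stab(t), c_1, …, c_j⟩`. [folklore] -/
theorem stabilizer_le_relSpan (t : V) (x a : B) (j : ℕ) : MulAction.stabilizer B t ≤ relSpan t x a j :=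
  fun _ hh => Subgroup.subset_closure (Set.mem_union_left _ hh)

/-- **Relative independence ⟹ injectivity ON THE ORBIT**: if `c_{j+1} ∉ ⟨Stab(t), c_1, …, c_j⟩` for all `j < m`, then `ε ↦ Q_m(ε) • t` is
injective on `{0,1}^m` (compare the LEFT-most letters: equal letters cancel as permutations of `V`; unequal ones put `c_{m}` into the relative
span). [cite: MilnorSolvableGrowth1968, p. 448 (minimal m, i_m ≠ j_m)] -/
theorem lword_smul_injective (t : V) (x a : B) : ∀ m : ℕ,
    (∀ j < m, Milnor.conj x a (j + 1) ∉ relSpan t x a j) → Function.Injective (fun ε : Fin m → Bool => lword x a m ε • t)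
  | 0, _ => fun ε δ _ => funext fun i => i.elim0
  | m + 1, hind => by
    intro ε δ h
    have ih := lword_smul_injective t x a m (fun j hj => hind j (by omega))
    simp only [lword, mul_smul] at h
    have hrel : ∀ (ε' δ' : Fin m → Bool), lword x a m ε' • t = Milnor.conj x a (m + 1) • lword x a m δ' • t → False := by
      intro ε' δ' e
      refine hind m (by omega) ?_
      set s : B := (lword x a m ε')⁻¹ * Milnor.conj x a (m + 1) * lword x a m δ' with hs
      have hsS : s ∈ MulAction.stabilizer B t := by
        rw [MulAction.mem_stabilizer_iff, hs, mul_smul, mul_smul, ← e, inv_smul_smul]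
      have e2 : Milnor.conj x a (m + 1) = lword x a m ε' * s * (lword x a m δ')⁻¹ := by rw [hs]; group
      rw [e2]
      exact mul_mem (mul_mem (closure_le_relSpan t x a m (lword_mem x a m ε')) (stabilizer_le_relSpan t x a m hsS))
        (inv_mem (closure_le_relSpan t x a m (lword_mem x a m δ')))
    have key : Fin.init ε = Fin.init δ ∧ ε (Fin.last m) = δ (Fin.last m) := by
      cases hε : ε (Fin.last m) <;> cases hδ : δ (Fin.last m)
      · simp only [hε, hδ, Bool.false_eq_true, ↓reduceIte, one_smul] at h
        exact ⟨ih h, rfl⟩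
      · simp only [hε, hδ, Bool.false_eq_true, ↓reduceIte, one_smul] at h
        exact (hrel _ _ h).elim
      · simp only [hε, hδ, Bool.false_eq_true, ↓reduceIte, one_smul] at h
        exact (hrel _ _ h.symm).elim
      · simp only [hε, hδ, ↓reduceIte] at h
        have h' := congrArg (fun v => (Milnor.conj x a (m + 1))⁻¹ • v) h
        simp only [inv_smul_smul] at h'
        exact ⟨ih h', rfl⟩
    calc ε = Fin.snoc (Fin.init ε) (ε (Fin.last m)) := (Fin.snoc_init_self ε).symm
      _ = Fin.snoc (Fin.init δ) (δ (Fin.last m)) := by rw [key.1, key.2]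
      _ = δ := Fin.snoc_init_self δ

/-! ## §4 Counting: injectivity on the orbit fills balls about `x^m • t`, i.e. about `t` -/

/-- **`2^m ≤ |B(t, mR)|`** when the `2^m` points `Q_m(ε) • t` are distinct and lie in `B(x^m • t, mR)` (the automorphism `x^m` carries balls about `t`
to balls about `x^m • t`). [cite: MilnorSolvableGrowth1968, p. 447 (g_S(m·const) ≥ 2^m)] -/
theorem two_pow_le_ballVolume [G.LocallyFinite] (hact : IsActionByAut G B) {t : V} {x a : B} {R m : ℕ}
    (hR : ∀ ε : Fin m → Bool, lword x a m ε • t ∈ graphBall G ((x ^ m) • t) (m * R))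
    (hinj : Function.Injective (fun ε : Fin m → Bool => lword x a m ε • t)) : 2 ^ m ≤ ballVolume G t (m * R) := by
  rw [← ballVolume_map_eq (smulIso hact (x ^ m)) t, smulIso_apply]
  have hsub : Set.range (fun ε : Fin m → Bool => lword x a m ε • t) ⊆ graphBall G ((x ^ m) • t) (m * R) := by
    rintro _ ⟨ε, rfl⟩
    exact hR ε
  calc 2 ^ m = (Set.range (fun ε : Fin m → Bool => lword x a m ε • t)).ncard := by
        rw [← Set.image_univ, Set.ncard_image_of_injective _ hinj, Set.ncard_univ, Nat.card_eq_fintype_card]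
        simp
    _ ≤ ballVolume G ((x ^ m) • t) (m * R) := Set.ncard_le_ncard hsub (graphBall_finite _ _ _)

/-! ## §5 Conclusion: under subexponential growth AT `t`, some conjugate is in the relative span of the earlier ones -/

/-- **RELATIVE MILNOR LEMMA (one conjugate, quantitative)**: if `|B(t, m(r_a + r_x + 1))| < 2^m`, then some conjugate `c_n = x^n a x^{-n}` with
`1 ≤ n ≤ m` lies in `⟨Stab(t), c_1, …, c_{n−1}⟩` — the bound `m` depends on `x, a` only through the displacements `r_x, r_a`.
[cite: MilnorSolvableGrowth1968, Lemma 1 pp. 447–448] [cite: Rosset1976, Thm. 1] -/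
theorem exists_conj_mem_relSpan_le [G.LocallyFinite] (hact : IsActionByAut G B) {t : V} (x a : B) {rx ra m : ℕ}
    (hx : x⁻¹ • t ∈ graphBall G t rx) (ha : a • t ∈ graphBall G t ra) (hm : ballVolume G t (m * (ra + rx + 1)) < 2 ^ m) :
    ∃ n : ℕ, 1 ≤ n ∧ n ≤ m ∧ Milnor.conj x a n ∈ relSpan t x a (n - 1) := by
  by_contra hne
  push Not at hne
  have hinj := lword_smul_injective t x a m (fun j hj => by
    have h := hne (j + 1) (by omega) (by omega)
    rwa [Nat.add_sub_cancel] at h)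
  have h2 := two_pow_le_ballVolume hact (R := ra + rx + 1)
    (fun ε => graphBall_mono _ _ (Nat.mul_le_mul_left m (by omega)) (lword_smul_mem hact hx ha m ε)) hinj
  exact absurd hm (not_lt.2 h2)

/-- **RELATIVE MILNOR LEMMA (one conjugate)**: if the balls about `t` grow subexponentially along every linear scale
(`∀ R ≥ 1 ∃ m, |B(t, mR)| < 2^m`), then for all `x, a` in a group acting by automorphisms some conjugate `c_n = x^n a x^{-n}`, `n ≥ 1`, lies in
`⟨Stab(t), c_1, …, c_{n−1}⟩`. [cite: MilnorSolvableGrowth1968, Lemma 1 pp. 447–448] [cite: Rosset1976, Thm. 1] -/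
theorem exists_conj_mem_relSpan [G.LocallyFinite] (hact : IsActionByAut G B) {t : V}
    (hsub : ∀ R : ℕ, 1 ≤ R → ∃ m : ℕ, ballVolume G t (m * R) < 2 ^ m) (x a : B) {rx ra : ℕ}
    (hx : x⁻¹ • t ∈ graphBall G t rx) (ha : a • t ∈ graphBall G t ra) :
    ∃ n : ℕ, 1 ≤ n ∧ Milnor.conj x a n ∈ relSpan t x a (n - 1) := by
  obtain ⟨m, hm⟩ := hsub (ra + rx + 1) (by omega)
  obtain ⟨n, h1, -, hn⟩ := exists_conj_mem_relSpan_le hact x a hx ha hm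
  exact ⟨n, h1, hn⟩

/-! ## §6 Reidemeister–Schreier over a generating SET: `⟨S₀⟩ ∩ ker ψ = ⟨x^k a_s x^{-k}⟩` -/

section RS

variable {Γ : Type} [Group Γ]

/-- The conjugates `x^k (a s) x^{-k}`, `s ∈ S₀`, `k ∈ ℤ`, over a generating SET. [cite: MilnorSolvableGrowth1968, p. 448 (α_k)] -/
def conjSet' (S₀ : Set Γ) (x : Γ) (a : Γ → Γ) : Set Γ := {g | ∃ s ∈ S₀, ∃ k : ℤ, g = x ^ k * a s * (x ^ k)⁻¹}

/-- `conjSet'` is stable under conjugation by powers of `x`. [cite: MilnorSolvableGrowth1968, p. 448] -/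
theorem zpow_conj_mem_conjSet' {S₀ : Set Γ} {x : Γ} {a : Γ → Γ} (j : ℤ) {g : Γ} (hg : g ∈ conjSet' S₀ x a) :
    x ^ j * g * (x ^ j)⁻¹ ∈ conjSet' S₀ x a := by
  obtain ⟨s, hs, k, rfl⟩ := hg
  refine ⟨s, hs, j + k, ?_⟩
  rw [zpow_add]
  group

/-- The span of `conjSet'` is stable under conjugation by powers of `x`. [cite: MilnorSolvableGrowth1968, p. 448] -/
theorem zpow_conj_mem_closure_conjSet' {S₀ : Set Γ} {x : Γ} {a : Γ → Γ} (j : ℤ) {g : Γ}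
    (hg : g ∈ Subgroup.closure (conjSet' S₀ x a)) : x ^ j * g * (x ^ j)⁻¹ ∈ Subgroup.closure (conjSet' S₀ x a) :=
  Milnor.conj_mem_of_closure (fun _ hy => Subgroup.subset_closure (zpow_conj_mem_conjSet' j hy)) hg

/-- **Decomposition `g = b · x^k`** over a generating set. [cite: MilnorSolvableGrowth1968, p. 449] -/
theorem exists_decomp' {S₀ : Set Γ} {x : Γ} {a : Γ → Γ} (hs : ∀ s ∈ S₀, ∃ k : ℤ, s = a s * x ^ k) {g : Γ}
    (hg : g ∈ Subgroup.closure S₀) : ∃ b ∈ Subgroup.closure (conjSet' S₀ x a), ∃ k : ℤ, g = b * x ^ k := by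
  induction hg using Subgroup.closure_induction with
  | mem s hsS =>
    obtain ⟨k, hk⟩ := hs s hsS
    exact ⟨a s, Subgroup.subset_closure ⟨s, hsS, 0, by simp⟩, k, hk⟩
  | one => exact ⟨1, one_mem _, 0, by simp⟩
  | mul y z _ _ hy hz =>
    obtain ⟨b₁, hb₁, k₁, rfl⟩ := hy
    obtain ⟨b₂, hb₂, k₂, rfl⟩ := hz
    refine ⟨b₁ * (x ^ k₁ * b₂ * (x ^ k₁)⁻¹), mul_mem hb₁ (zpow_conj_mem_closure_conjSet' k₁ hb₂), k₁ + k₂, ?_⟩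
    rw [zpow_add]
    group
  | inv y _ hy =>
    obtain ⟨b, hb, k, rfl⟩ := hy
    refine ⟨x ^ (-k) * b⁻¹ * (x ^ (-k))⁻¹, zpow_conj_mem_closure_conjSet' (-k) (inv_mem hb), -k, ?_⟩
    rw [zpow_neg]
    group

/-- **`⟨S₀⟩ ∩ ker ψ` is the span of the conjugates** `x^k a_s x^{-k}` when `x ∈ ⟨S₀⟩`, `a_s ∈ ker ψ`, `s = a_s x^{k_s}` and no non-trivial power of
`x` lies in `ker ψ` (generating SET). [cite: MilnorSolvableGrowth1968, Lemma 1 and p. 449] [cite: Rosset1976, Thm. 1 (proof)] -/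
theorem closure_inf_ker_eq' {M : Type*} [Group M] (ψ : Γ →* M) (S₀ : Set Γ) (x : Γ) (a : Γ → Γ)
    (hx : x ∈ Subgroup.closure S₀) (ha : ∀ s ∈ S₀, a s ∈ ψ.ker) (hs : ∀ s ∈ S₀, ∃ k : ℤ, s = a s * x ^ k)
    (hinj : ∀ k : ℤ, x ^ k ∈ ψ.ker → k = 0) :
    Subgroup.closure S₀ ⊓ ψ.ker = Subgroup.closure (conjSet' S₀ x a) := by
  refine le_antisymm ?_ ((Subgroup.closure_le _).2 ?_)
  · rintro g ⟨hgS, hgK⟩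
    obtain ⟨b, hb, k, rfl⟩ := exists_decomp' hs hgS
    have hbK : b ∈ ψ.ker := by
      refine (Subgroup.closure_le ψ.ker).2 ?_ hb
      rintro _ ⟨s, hsS, j, rfl⟩
      exact (inferInstance : ψ.ker.Normal).conj_mem _ (ha s hsS) (x ^ j)
    have hk : x ^ k ∈ ψ.ker := by
      have := mul_mem (inv_mem hbK) hgK
      rwa [inv_mul_cancel_left] at this
    rw [hinj k hk, zpow_zero, mul_one]
    exact hb
  · rintro _ ⟨s, hsS, j, rfl⟩
    refine Subgroup.mem_inf.2 ⟨?_, ?_⟩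
    · have has : a s ∈ Subgroup.closure S₀ := by
        obtain ⟨k, hk⟩ := hs s hsS
        have e : a s = s * (x ^ k)⁻¹ := eq_mul_inv_iff_mul_eq.2 hk.symm
        rw [e]
        exact mul_mem (Subgroup.subset_closure hsS) (inv_mem (zpow_mem hx k))
      exact mul_mem (mul_mem (zpow_mem hx j) has) (inv_mem (zpow_mem hx j))
    · exact (inferInstance : ψ.ker.Normal).conj_mem _ (ha s hsS) (x ^ j)

/-- The image of a subgroup under an additive character, as an additive subgroup of `ℤ`. [folklore] -/
def imageSub' (f : Γ →* Multiplicative ℤ) (B' : Subgroup Γ) : AddSubgroup ℤ where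
  carrier := {z | ∃ g ∈ B', Multiplicative.toAdd (f g) = z}
  zero_mem' := ⟨1, one_mem _, by simp⟩
  add_mem' := by
    rintro _ _ ⟨g, hg, rfl⟩ ⟨h, hh, rfl⟩
    exact ⟨g * h, mul_mem hg hh, by rw [map_mul, toAdd_mul]⟩
  neg_mem' := by
    rintro _ ⟨g, hg, rfl⟩
    exact ⟨g⁻¹, inv_mem hg, by rw [map_inv, toAdd_inv]⟩

/-- **A generator of the image is attained on the subgroup** (subgroups of `ℤ` are cyclic). [folklore] -/
theorem exists_generator' (f : Γ →* Multiplicative ℤ) (B' : Subgroup Γ) : ∃ x ∈ B',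
    ∀ g ∈ B', ∃ k : ℤ, Multiplicative.toAdd (f g) = k * Multiplicative.toAdd (f x) := by
  obtain ⟨d, hd⟩ := Int.subgroup_cyclic (imageSub' f B')
  have hdmem : d ∈ imageSub' f B' := by
    rw [hd]
    exact AddSubgroup.subset_closure (Set.mem_singleton d)
  obtain ⟨x, hx, hfx⟩ := hdmem
  refine ⟨x, hx, fun g hg => ?_⟩
  have hgmem : Multiplicative.toAdd (f g) ∈ imageSub' f B' := ⟨g, hg, rfl⟩
  rw [hd, AddSubgroup.mem_closure_singleton] at hgmem
  obtain ⟨k, hk⟩ := hgmem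
  exact ⟨k, by rw [hfx, ← hk, smul_eq_mul]⟩

end RS

end AutMilnor

end Summit.CriticalPhenomena.PercolationContinuityZ3.Theorems.Transplant

end
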